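import Literature.Probability.Percolation.GladkovThreeClusterDichotomyProofs
import Literature.Probability.LatticeModels.ProdBernoulliIndependence
import Literature.Probability.Percolation.PercolationEvents
import Literature.Computation.FiniteGraph.ReliabilityBridge
import Literature.Probability.Percolation.Crossings
import Literature.Probability.LatticeModels.IsoradialPercolationProofs
import Mathlib.Tactic.Linarith
import Mathlib.Tactic.Positivity
import HarnessLib

/-!
# `NoHeavyLowerTail` (stmt-CriticalPhenomena-4575) — the reverse-Harris three-point row APL holds with constant `(2/3)·P(a|b|c)`

Support file (prover prim-ineq-prove-5 gen 37; `--supports stmt-CriticalPhenomena-4575`; memo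
run/shared/lean/prim/prim-ineq-prove-5/FROM-prim-ineq-prove-5-g37-APL-STRUCTURE.md §3.2).  No named facts, no sorries.

SETTING.  Bond percolation `prodBernoulli w` on the pairs of a finite vertex type, three vertices `a, b, c`, and the
five cells of the partition of `{a,b,c}` induced by the open clusters: `u0 = P(a|b|c)`, `u_ab = P(ab|c) = P({a↔b} ∩ {a↔c}ᶜ)`,
`u_ac = P(ac|b)`, `u_bc = P(bc|a)`, `u3 = P(abc)`.  The conjectured row APL of the new-inequality factory (prim-ineq-gen-8,
board rows gen8g8-APL° / CONJECTURE APL(2/3)) is the REVERSE-Harris inequality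
`P(ab|c) + P(ac|b) ≥ c · P(b ↮ c) · P(a ↔ b ∪ a ↔ c)` with a universal constant (`2/3` conjectured); Harris gives `≤` with `c = 1`.

WHAT IS PROVED HERE (the part of APL that follows from print).  From Gladkov 2024, Lemma 1.2 — the tree theorem
`gladkov2024_lemma_1_2_prodBernoulli` (arXiv:2408.08457, (2); used with `a` and `b` interchanged, i.e. display (17) of §7.2) —
plus `(q − Z)² ≥ 0` and Harris' inequality for the two decreasing events `{a ↮ b} ∩ {a ↮ c}` and `{b ↮ c}`:
* `apl_sq_le`      : `P(a|b|c)² · P(a↔b ∪ a↔c) ≤ (3/2) · P({a↮b} ∩ {a↮c}) · (P(ab|c) + P(ac|b))`;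
* `apl_of_tri`     : `P(a|b|c) · P(b↮c) · P(a↔b ∪ a↔c) ≤ (3/2) · (P(ab|c) + P(ac|b))` — APL with constant `(2/3)·P(a|b|c)`:
                     `P(ab|c)+P(ac|b) ≥ (2/3)·P(a|b|c) · [P(b↮c) · P(a↔b ∪ a↔c)]`;
* `abc_mul_tri_sq_le` : `P(abc) · P(a|b|c)² ≤ (3/2) · (P(ab|c) + P(ac|b))`, the printed cubic rate of Gladkov's Thm 1.3 with the
                     constant `4·max` of `gladkov2024_thm_1_3_rate_max` improved to `(3/2)·sum`;
* `apl_of_tri_offApex` (appended): the same with `P(b↮c)` replaced by the larger `P(b ↮ c off a) = P({b ↔ c in V∖{a}}ᶜ)`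
                     (`openConnIn {a}ᶜ b c`), i.e. `Φ ≥ (2/3)·P(a|b|c)·P(b↮c off a)/P(b↮c)`; in particular `Φ ≥ min(1/2, P(b↮c off a)/3)`.
So the linear (in `P(a|b|c)`) rate conjectured by the factory holds off the corner `P(a|b|c) → 0`; the corner (hub clouds, deep
trees: `P(a|b|c) = ((3−2z)/4)^k`) is exactly where a new idea is needed (memo §4).
[cite: Gladkov2024, Lemma 1.2 (2) and §7.2 (17), arXiv:2408.08457] [cite: Grimmett1999, Thm. (2.4) (Harris)]
-/

noncomputable section

namespace Summit.CriticalPhenomena.PercolationContinuityZ3.Theorems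

namespace APL

open MeasureTheory Literature.Probability.Percolation Literature.Probability.LatticeModels
open Literature.Computation.FiniteGraph (measurableSet_of_fintype)

section SetLemmas

variable {V : Type}

/-- Cell decomposition `{a↮c} ∩ {b↮c} = (ab|c) ⊔ (a|b|c)`: if `c` is separated from `a` and from `b`, then either
`a ↔ b` (cell `ab|c`) or all three are separated. [folklore] -/
theorem isoC_eq_union (a b c : V) :
    ((openConn a c)ᶜ ∩ (openConn b c)ᶜ : Set (BondConfig V)) =
      (openConn a b ∩ (openConn a c)ᶜ) ∪ ((openConn a b)ᶜ ∩ (openConn a c)ᶜ ∩ (openConn b c)ᶜ) := by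
  ext ω
  simp only [Set.mem_inter_iff, Set.mem_compl_iff, Set.mem_union]
  constructor
  · rintro ⟨hac, hbc⟩
    by_cases hab : ω ∈ openConn a b
    · exact Or.inl ⟨hab, hac⟩
    · exact Or.inr ⟨⟨hab, hac⟩, hbc⟩
  · rintro (⟨hab, hac⟩ | ⟨⟨-, hac⟩, hbc⟩)
    · refine ⟨hac, fun hbc => hac ?_⟩
      exact SimpleGraph.Reachable.trans hab hbc
    · exact ⟨hac, hbc⟩

/-- Cell decomposition `{a↮b} ∩ {b↮c} = (ac|b) ⊔ (a|b|c)`. [folklore] -/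
theorem isoB_eq_union (a b c : V) :
    ((openConn a b)ᶜ ∩ (openConn b c)ᶜ : Set (BondConfig V)) =
      (openConn a c ∩ (openConn a b)ᶜ) ∪ ((openConn a b)ᶜ ∩ (openConn a c)ᶜ ∩ (openConn b c)ᶜ) := by
  ext ω
  simp only [Set.mem_inter_iff, Set.mem_compl_iff, Set.mem_union]
  constructor
  · rintro ⟨hab, hbc⟩
    by_cases hac : ω ∈ openConn a c
    · exact Or.inl ⟨hac, hab⟩
    · exact Or.inr ⟨⟨hab, hac⟩, hbc⟩
  · rintro (⟨hac, hab⟩ | ⟨⟨hab, -⟩, hbc⟩)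
    · refine ⟨hab, fun hbc => hab ?_⟩
      exact SimpleGraph.Reachable.trans hac (SimpleGraph.Reachable.symm hbc)
    · exact ⟨hab, hbc⟩

/-- The two pieces of `isoC_eq_union` are disjoint. [folklore] -/
theorem disjoint_isoC (a b c : V) :
    Disjoint (openConn a b ∩ (openConn a c)ᶜ : Set (BondConfig V))
      ((openConn a b)ᶜ ∩ (openConn a c)ᶜ ∩ (openConn b c)ᶜ) :=
  Set.disjoint_left.2 fun _ h1 h2 => h2.1.1 h1.1

/-- The two pieces of `isoB_eq_union` are disjoint. [folklore] -/
theorem disjoint_isoB (a b c : V) :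
    Disjoint (openConn a c ∩ (openConn a b)ᶜ : Set (BondConfig V))
      ((openConn a b)ᶜ ∩ (openConn a c)ᶜ ∩ (openConn b c)ᶜ) :=
  Set.disjoint_left.2 fun _ h1 h2 => h2.1.2 h1.1

end SetLemmas

/-- **The algebra of the linear regime.**  From Gladkov's (17) `q²/X + q²/Z ≤ q + Y²` with `0 ≤ q ≤ X ≤ 1`, `q ≤ Z`,
`Y = q + u_ac ≤ 1`, `Z = q + u_ab`, `u_ab, u_ac ≥ 0` (here `0 ≤ q ≤ X`):  `q² (1 − X) ≤ X · (u_ab + 2 u_ac)`. [this work] -/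
theorem regime_algebra {q X Y Z uab uac : ℝ} (hq0 : 0 ≤ q) (hqX : q ≤ X) (hZ : Z = q + uab)
    (hY : Y = q + uac) (hY1 : Y ≤ 1) (huab : 0 ≤ uab) (huac : 0 ≤ uac)
    (h17 : q ^ 2 / X + q ^ 2 / Z ≤ q + Y ^ 2) :
    q ^ 2 * (1 - X) ≤ X * (uab + 2 * uac) := by
  rcases eq_or_lt_of_le hq0 with hq | hq
  · rw [← hq]
    nlinarith
  have hXpos : 0 < X := lt_of_lt_of_le hq hqX
  have hZpos : 0 < Z := by rw [hZ]; linarith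
  -- `q − q²/Z ≤ Z − q` since `(q − Z)² ≥ 0`
  have h1 : q - q ^ 2 / Z ≤ Z - q := by
    rw [sub_le_iff_le_add, ← sub_le_iff_le_add']
    rw [le_div_iff₀ hZpos]
    nlinarith [sq_nonneg (q - Z)]
  have h2 : q ^ 2 / X ≤ uab + Y ^ 2 := by
    have : q ^ 2 / X ≤ q + Y ^ 2 - q ^ 2 / Z := by linarith
    linarith
  have h3 : q ^ 2 ≤ X * (uab + Y ^ 2) := by
    have := (div_le_iff₀ hXpos).1 h2
    linarith
  rw [hY] at h3 hY1
  nlinarith [mul_nonneg (le_of_lt hXpos) huac, mul_nonneg (mul_nonneg (le_of_lt hXpos) huac) hq0,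
    mul_nonneg (mul_nonneg (le_of_lt hXpos) huac) huac]

section Measure

variable {V : Type} [Fintype V]

/-- **Gladkov's (17) for `prodBernoulli w`, measure form**: Lemma 1.2 with `a` and `b` interchanged,
`q²/P({a↮b}∩{a↮c}) + q²/P({a↮c}∩{b↮c}) ≤ q + P({a↮b}∩{b↮c})²`, `q = P(a|b|c)`.
[cite: Gladkov2024, §7.2 (17), arXiv:2408.08457] -/
theorem gladkov17 (w : Sym2 V → unitInterval) (a b c : V) :
    (prodBernoulli w).real ((openConn a b)ᶜ ∩ (openConn a c)ᶜ ∩ (openConn b c)ᶜ) ^ 2 /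
          (prodBernoulli w).real ((openConn a b)ᶜ ∩ (openConn a c)ᶜ) +
        (prodBernoulli w).real ((openConn a b)ᶜ ∩ (openConn a c)ᶜ ∩ (openConn b c)ᶜ) ^ 2 /
          (prodBernoulli w).real ((openConn a c)ᶜ ∩ (openConn b c)ᶜ) ≤
      (prodBernoulli w).real ((openConn a b)ᶜ ∩ (openConn a c)ᶜ ∩ (openConn b c)ᶜ) +
        (prodBernoulli w).real ((openConn a b)ᶜ ∩ (openConn b c)ᶜ) ^ 2 := by
  have h := gladkov2024_lemma_1_2_prodBernoulli w b a c
  have hsw : ∀ x y : V, (openConn x y : Set (BondConfig V)) = openConn y x := fun x y =>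
    Set.ext fun _ => ⟨fun h => SimpleGraph.Reachable.symm h, fun h => SimpleGraph.Reachable.symm h⟩
  have e1 : ((openConn b a)ᶜ ∩ (openConn b c)ᶜ ∩ (openConn a c)ᶜ : Set (BondConfig V)) =
      (openConn a b)ᶜ ∩ (openConn a c)ᶜ ∩ (openConn b c)ᶜ := by
    rw [hsw b a, Set.inter_assoc, Set.inter_comm ((openConn b c)ᶜ), ← Set.inter_assoc]
  have e2 : ((openConn b a)ᶜ ∩ (openConn a c)ᶜ : Set (BondConfig V)) = (openConn a b)ᶜ ∩ (openConn a c)ᶜ := by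
    rw [hsw b a]
  have e3 : ((openConn b c)ᶜ ∩ (openConn a c)ᶜ : Set (BondConfig V)) = (openConn a c)ᶜ ∩ (openConn b c)ᶜ :=
    Set.inter_comm _ _
  have e4 : ((openConn b a)ᶜ ∩ (openConn b c)ᶜ : Set (BondConfig V)) = (openConn a b)ᶜ ∩ (openConn b c)ᶜ := by
    rw [hsw b a]
  rw [e1, e2, e3, e4] at h
  exact h

/-- **APL, squared form**: `P(a|b|c)² · P(a↔b ∪ a↔c) ≤ (3/2) · P({a↮b}∩{a↮c}) · (P(ab|c) + P(ac|b))`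
(Gladkov's (17), the algebra `regime_algebra`, and its mirror image under `b ↔ c`). [this work] -/
theorem apl_sq_le (w : Sym2 V → unitInterval) (a b c : V) :
    (prodBernoulli w).real ((openConn a b)ᶜ ∩ (openConn a c)ᶜ ∩ (openConn b c)ᶜ) ^ 2 *
        (prodBernoulli w).real (openConn a b ∪ openConn a c) ≤
      3 / 2 * (prodBernoulli w).real ((openConn a b)ᶜ ∩ (openConn a c)ᶜ) *
        ((prodBernoulli w).real (openConn a b ∩ (openConn a c)ᶜ) +
          (prodBernoulli w).real (openConn a c ∩ (openConn a b)ᶜ)) := by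
  have hm : ∀ A : Set (BondConfig V), MeasurableSet A := fun A => measurableSet_of_fintype A
  have hsw : ∀ x y : V, (openConn x y : Set (BondConfig V)) = openConn y x := fun x y =>
    Set.ext fun _ => ⟨fun h => SimpleGraph.Reachable.symm h, fun h => SimpleGraph.Reachable.symm h⟩
  set μ := prodBernoulli w with hμ
  set q := μ.real ((openConn a b)ᶜ ∩ (openConn a c)ᶜ ∩ (openConn b c)ᶜ) with hq
  set X := μ.real ((openConn a b)ᶜ ∩ (openConn a c)ᶜ) with hX
  set uab := μ.real (openConn a b ∩ (openConn a c)ᶜ) with huab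
  set uac := μ.real (openConn a c ∩ (openConn a b)ᶜ) with huac
  -- the cells
  have hZ : μ.real ((openConn a c)ᶜ ∩ (openConn b c)ᶜ) = q + uab := by
    rw [isoC_eq_union, measureReal_union (disjoint_isoC a b c) (hm _), add_comm]
  have hY : μ.real ((openConn a b)ᶜ ∩ (openConn b c)ᶜ) = q + uac := by
    rw [isoB_eq_union, measureReal_union (disjoint_isoB a b c) (hm _), add_comm]
  have hT : μ.real (openConn a b ∪ openConn a c) = 1 - X := by
    rw [show (openConn a b ∪ openConn a c : Set (BondConfig V)) = ((openConn a b)ᶜ ∩ (openConn a c)ᶜ)ᶜ by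
        rw [Set.compl_inter, compl_compl, compl_compl], probReal_compl_eq_one_sub (hm _)]
  have hq0 : 0 ≤ q := measureReal_nonneg
  have hqX : q ≤ X := measureReal_mono (Set.inter_subset_left)
  have hX1 : X ≤ 1 := measureReal_le_one
  have hY1 : μ.real ((openConn a b)ᶜ ∩ (openConn b c)ᶜ) ≤ 1 := measureReal_le_one
  have hZ1 : μ.real ((openConn a c)ᶜ ∩ (openConn b c)ᶜ) ≤ 1 := measureReal_le_one
  have huab0 : 0 ≤ uab := measureReal_nonneg
  have huac0 : 0 ≤ uac := measureReal_nonneg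
  -- (17) with apex `a`, and its mirror image (swap `b` and `c`)
  have h17 := gladkov17 w a b c
  have h17' := gladkov17 w a c b
  have eq1 : ((openConn a c)ᶜ ∩ (openConn a b)ᶜ ∩ (openConn c b)ᶜ : Set (BondConfig V)) =
      (openConn a b)ᶜ ∩ (openConn a c)ᶜ ∩ (openConn b c)ᶜ := by
    rw [hsw c b, Set.inter_comm ((openConn a c)ᶜ)]
  have eq2 : ((openConn a c)ᶜ ∩ (openConn a b)ᶜ : Set (BondConfig V)) = (openConn a b)ᶜ ∩ (openConn a c)ᶜ :=
    Set.inter_comm _ _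
  have eq3 : ((openConn a b)ᶜ ∩ (openConn c b)ᶜ : Set (BondConfig V)) = (openConn a b)ᶜ ∩ (openConn b c)ᶜ := by
    rw [hsw c b]
  have eq4 : ((openConn a c)ᶜ ∩ (openConn c b)ᶜ : Set (BondConfig V)) = (openConn a c)ᶜ ∩ (openConn b c)ᶜ := by
    rw [hsw c b]
  rw [eq1, eq2, eq3, eq4] at h17'
  rw [← hμ] at h17 h17'
  rw [← hq, ← hX, hZ, hY] at h17
  rw [← hq, ← hX, hZ, hY] at h17'
  have A1 := regime_algebra hq0 hqX rfl rfl (hY ▸ hY1) huab0 huac0 h17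
  have A2 := regime_algebra hq0 hqX rfl rfl (hZ ▸ hZ1) huac0 huab0 h17'
  rw [hT]
  have hX0 : 0 ≤ X := measureReal_nonneg
  nlinarith

/-- **APL with constant `(2/3)·P(a|b|c)`** (reverse-Harris three-point row in the regime `P(a|b|c)` bounded below):
`P(a|b|c) · P(b↮c) · P(a↔b ∪ a↔c) ≤ (3/2) · (P(ab|c) + P(ac|b))`.  From `apl_sq_le` and Harris for the decreasing events
`{a↮b}∩{a↮c}`, `{b↮c}` (their intersection is `a|b|c`). [this work] -/
theorem apl_of_tri (w : Sym2 V → unitInterval) (a b c : V) :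
    (prodBernoulli w).real ((openConn a b)ᶜ ∩ (openConn a c)ᶜ ∩ (openConn b c)ᶜ) *
        (prodBernoulli w).real (openConn b c)ᶜ * (prodBernoulli w).real (openConn a b ∪ openConn a c) ≤
      3 / 2 * ((prodBernoulli w).real (openConn a b ∩ (openConn a c)ᶜ) +
        (prodBernoulli w).real (openConn a c ∩ (openConn a b)ᶜ)) := by
  have hm : ∀ A : Set (BondConfig V), MeasurableSet A := fun A => measurableSet_of_fintype A
  have hsq := apl_sq_le w a b c
  -- Harris: P({a↮b}∩{a↮c}) · P(b↮c) ≤ P(a|b|c)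
  have hlowX : IsLowerSet ((openConn a b)ᶜ ∩ (openConn a c)ᶜ : Set (BondConfig V)) :=
    ((isUpperSet_openConn a b).compl).inter ((isUpperSet_openConn a c).compl)
  have hlowB : IsLowerSet ((openConn b c)ᶜ : Set (BondConfig V)) := (isUpperSet_openConn b c).compl
  have hH := prodBernoulli_harris_lower w hlowX hlowB (hm _) (hm _)
  set μ := prodBernoulli w
  set q := μ.real ((openConn a b)ᶜ ∩ (openConn a c)ᶜ ∩ (openConn b c)ᶜ)
  set X := μ.real ((openConn a b)ᶜ ∩ (openConn a c)ᶜ)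
  set B := μ.real (openConn b c)ᶜ
  set T := μ.real (openConn a b ∪ openConn a c)
  set e := μ.real (openConn a b ∩ (openConn a c)ᶜ) + μ.real (openConn a c ∩ (openConn a b)ᶜ)
  have hq0 : 0 ≤ q := measureReal_nonneg
  have hB0 : 0 ≤ B := measureReal_nonneg
  have hT0 : 0 ≤ T := measureReal_nonneg
  have hX0 : 0 ≤ X := measureReal_nonneg
  have he0 : 0 ≤ e := add_nonneg measureReal_nonneg measureReal_nonneg
  -- `hH : X * B ≤ q`, `hsq : q^2 * T ≤ 3/2 * X * e`
  rcases eq_or_lt_of_le hq0 with hq | hq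
  · rw [← hq]
    simp only [zero_mul]
    positivity
  · -- multiply `hsq` by `B`, use `X * B ≤ q`, divide by `q > 0`
    have h1 : q ^ 2 * T * B ≤ 3 / 2 * X * e * B := mul_le_mul_of_nonneg_right hsq hB0
    have h2 : 3 / 2 * X * e * B ≤ 3 / 2 * q * e := by
      have := mul_le_mul_of_nonneg_left hH (by positivity : (0 : ℝ) ≤ 3 / 2 * e)
      nlinarith
    have h3 : q * (q * B * T) ≤ q * (3 / 2 * e) := by nlinarith
    have h4 := le_of_mul_le_mul_left h3 hq
    nlinarith

/-- **Gladkov's cubic rate with constant `3/2`**: `P(abc) · P(a|b|c)² ≤ (3/2) · (P(ab|c) + P(ac|b))`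
(cf. `gladkov2024_thm_1_3_rate_max`: `≤ 4 · max(P(ab|c), P(ac|b))`). [this work] -/
theorem abc_mul_tri_sq_le (w : Sym2 V → unitInterval) (a b c : V) :
    (prodBernoulli w).real (openConn a b ∩ openConn a c) *
        (prodBernoulli w).real ((openConn a b)ᶜ ∩ (openConn a c)ᶜ ∩ (openConn b c)ᶜ) ^ 2 ≤
      3 / 2 * ((prodBernoulli w).real (openConn a b ∩ (openConn a c)ᶜ) +
        (prodBernoulli w).real (openConn a c ∩ (openConn a b)ᶜ)) := by
  have hsq := apl_sq_le w a b c
  have hsub : (openConn a b ∩ openConn a c : Set (BondConfig V)) ⊆ openConn a b ∪ openConn a c :=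
    fun _ h => Or.inl h.1
  have hmono : (prodBernoulli w).real (openConn a b ∩ openConn a c) ≤
      (prodBernoulli w).real (openConn a b ∪ openConn a c) := measureReal_mono hsub
  have hX1 : (prodBernoulli w).real ((openConn a b)ᶜ ∩ (openConn a c)ᶜ) ≤ 1 := measureReal_le_one
  have hX0 : 0 ≤ (prodBernoulli w).real ((openConn a b)ᶜ ∩ (openConn a c)ᶜ) := measureReal_nonneg
  have he0 : 0 ≤ (prodBernoulli w).real (openConn a b ∩ (openConn a c)ᶜ) +
      (prodBernoulli w).real (openConn a c ∩ (openConn a b)ᶜ) := add_nonneg measureReal_nonneg measureReal_nonneg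
  have hq2 : 0 ≤ (prodBernoulli w).real ((openConn a b)ᶜ ∩ (openConn a c)ᶜ ∩ (openConn b c)ᶜ) ^ 2 := sq_nonneg _
  calc (prodBernoulli w).real (openConn a b ∩ openConn a c) *
        (prodBernoulli w).real ((openConn a b)ᶜ ∩ (openConn a c)ᶜ ∩ (openConn b c)ᶜ) ^ 2
      ≤ (prodBernoulli w).real (openConn a b ∪ openConn a c) *
        (prodBernoulli w).real ((openConn a b)ᶜ ∩ (openConn a c)ᶜ ∩ (openConn b c)ᶜ) ^ 2 :=
        mul_le_mul_of_nonneg_right hmono hq2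
    _ = (prodBernoulli w).real ((openConn a b)ᶜ ∩ (openConn a c)ᶜ ∩ (openConn b c)ᶜ) ^ 2 *
        (prodBernoulli w).real (openConn a b ∪ openConn a c) := mul_comm _ _
    _ ≤ 3 / 2 * (prodBernoulli w).real ((openConn a b)ᶜ ∩ (openConn a c)ᶜ) *
        ((prodBernoulli w).real (openConn a b ∩ (openConn a c)ᶜ) +
          (prodBernoulli w).real (openConn a c ∩ (openConn a b)ᶜ)) := hsq
    _ ≤ 3 / 2 * 1 * ((prodBernoulli w).real (openConn a b ∩ (openConn a c)ᶜ) +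
          (prodBernoulli w).real (openConn a c ∩ (openConn a b)ᶜ)) := by
        gcongr
    _ = _ := by ring

end Measure

/-! ### Appendix: the separation event "off the apex" -/

section OffApexSets

variable {V : Type}

/-- `{b ↔ c in V∖{a}} ⊆ {b ↔ c}`. [folklore] -/
theorem openConnIn_compl_subset (a b c : V) :
    (openConnIn ({a}ᶜ : Set V) b c : Set (BondConfig V)) ⊆ openConn b c := by
  intro ω hω
  obtain ⟨wk, -⟩ := (Literature.Probability.LatticeModels.mem_openConnIn_iff_exists_openWalk).1 hω
  exact ⟨wk⟩

/-- If `a` is joined to neither `b` nor `c`, then `b ↔ c` iff `b ↔ c` off `a`: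
`{a↮b} ∩ {a↮c} ∩ {b ↔ c off a}ᶜ = a|b|c`. [folklore] -/
theorem isoA_inter_offApex_eq (a b c : V) :
    ((openConn a b)ᶜ ∩ (openConn a c)ᶜ ∩ (openConnIn ({a}ᶜ : Set V) b c)ᶜ : Set (BondConfig V)) =
      (openConn a b)ᶜ ∩ (openConn a c)ᶜ ∩ (openConn b c)ᶜ := by
  classical
  ext ω
  simp only [Set.mem_inter_iff, Set.mem_compl_iff]
  constructor
  · rintro ⟨⟨hab, hac⟩, hoff⟩
    refine ⟨⟨hab, hac⟩, fun hbc => ?_⟩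
    obtain ⟨wk⟩ := (hbc : (openGraph ω).Reachable b c)
    by_cases ha : a ∈ wk.support
    · exact hab (SimpleGraph.Reachable.symm ⟨wk.takeUntil a ha⟩)
    · refine hoff ((Literature.Probability.LatticeModels.mem_openConnIn_iff_exists_openWalk).2 ⟨wk, ?_⟩)
      intro v hv hva
      exact ha (by rwa [Set.mem_singleton_iff.1 hva] at hv)
  · rintro ⟨⟨hab, hac⟩, hbc⟩
    exact ⟨⟨hab, hac⟩, fun h => hbc (openConnIn_compl_subset a b c h)⟩

end OffApexSets

section OffApexMeasure

variable {V : Type} [Fintype V]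

/-- **APL with constant `(2/3)·P(a|b|c)`, separation measured off the apex**:
`P(a|b|c) · P(b ↮ c off a) · P(a↔b ∪ a↔c) ≤ (3/2) · (P(ab|c) + P(ac|b))`, where `{b ↔ c off a} = openConnIn {a}ᶜ b c`
(so `P(b ↮ c off a) ≥ P(b ↮ c)`, and this sharpens `apl_of_tri`).  Harris is applied to the decreasing events `{a↮b}∩{a↮c}` and
`{b ↮ c off a}`, whose intersection is again `a|b|c` (`isoA_inter_offApex_eq`). [this work] -/
theorem apl_of_tri_offApex (w : Sym2 V → unitInterval) (a b c : V) :
    (prodBernoulli w).real ((openConn a b)ᶜ ∩ (openConn a c)ᶜ ∩ (openConn b c)ᶜ) *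
        (prodBernoulli w).real (openConnIn ({a}ᶜ : Set V) b c)ᶜ *
          (prodBernoulli w).real (openConn a b ∪ openConn a c) ≤
      3 / 2 * ((prodBernoulli w).real (openConn a b ∩ (openConn a c)ᶜ) +
        (prodBernoulli w).real (openConn a c ∩ (openConn a b)ᶜ)) := by
  have hm : ∀ A : Set (BondConfig V), MeasurableSet A := fun A => measurableSet_of_fintype A
  have hsq := apl_sq_le w a b c
  have hlowX : IsLowerSet ((openConn a b)ᶜ ∩ (openConn a c)ᶜ : Set (BondConfig V)) :=
    ((isUpperSet_openConn a b).compl).inter ((isUpperSet_openConn a c).compl)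
  have hlowB : IsLowerSet ((openConnIn ({a}ᶜ : Set V) b c)ᶜ : Set (BondConfig V)) :=
    (isUpperSet_openConnIn ({a}ᶜ : Set V) b c).compl
  have hH := prodBernoulli_harris_lower w hlowX hlowB (hm _) (hm _)
  rw [isoA_inter_offApex_eq] at hH
  set μ := prodBernoulli w
  set q := μ.real ((openConn a b)ᶜ ∩ (openConn a c)ᶜ ∩ (openConn b c)ᶜ)
  set X := μ.real ((openConn a b)ᶜ ∩ (openConn a c)ᶜ)
  set B := μ.real (openConnIn ({a}ᶜ : Set V) b c)ᶜ
  set T := μ.real (openConn a b ∪ openConn a c)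
  set e := μ.real (openConn a b ∩ (openConn a c)ᶜ) + μ.real (openConn a c ∩ (openConn a b)ᶜ)
  have hq0 : 0 ≤ q := measureReal_nonneg
  have hB0 : 0 ≤ B := measureReal_nonneg
  have hT0 : 0 ≤ T := measureReal_nonneg
  have hX0 : 0 ≤ X := measureReal_nonneg
  have he0 : 0 ≤ e := add_nonneg measureReal_nonneg measureReal_nonneg
  rcases eq_or_lt_of_le hq0 with hq | hq
  · rw [← hq]
    simp only [zero_mul]
    positivity
  · have h1 : q ^ 2 * T * B ≤ 3 / 2 * X * e * B := mul_le_mul_of_nonneg_right hsq hB0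
    have h2 : 3 / 2 * X * e * B ≤ 3 / 2 * q * e := by
      have := mul_le_mul_of_nonneg_left hH (by positivity : (0 : ℝ) ≤ 3 / 2 * e)
      nlinarith
    have h3 : q * (q * B * T) ≤ q * (3 / 2 * e) := by nlinarith
    have h4 := le_of_mul_le_mul_left h3 hq
    nlinarith

end OffApexMeasure

end APL

end Summit.CriticalPhenomena.PercolationContinuityZ3.Theorems

end
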